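import Literature.NumberTheory.LFunctions.SinnottPowerFunctions
import Mathlib.Data.ZMod.Units
import Mathlib.FieldTheory.Finite.Basic
import HarnessLib

/-!
# The unit group `(ℤ/M^m)ˣ = V × U` in Sinnott's proof of Washington's theorem

Topic `Literature/NumberTheory/LFunctions`; namespace `Literature.NumberTheory.LFunctions.Sinnott1987`.
THEOREMS ONLY (auxiliary `def`s with bodies; no named facts).

Elementary structure of `(ℤ/M^m)ˣ` used in the finite form of Sinnott's Lemma 3.6 / Theorem 3.2
(W. Sinnott, *On a theorem of L. Washington*, Astérisque 147–148 (1987), §1.1 and §3):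
`ℤ_Mˣ = V × U` with `V` the torsion (`μ_{M-1}`, resp. `{±1}` for `M = 2`) and `U = 1 + Mℤ_M`
(resp. `1 + 4ℤ₂`).  At the finite level `M^m`:

* `depth M` — `1` for odd `M`, `2` for `M = 2` (so `U = 1 + M^{depth} ℤ_M`).
* `IsTors` — the predicate "`u ∈ V`": `u^{M-1} = 1` (odd `M`), `u = ±1` (`M = 2`); a subgroup.
* `unitOneAdd j k` — the unit `1 + M^j k`; `congOne_iff_exists` — the units `≡ 1 (mod M^j)` are
  exactly the `1 + M^j k`, `k < M^{m-j}` ("`K_j`").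
* `padicValNat_pow_sub_one` — lifting the exponent `v_M(w^k - 1) = v_M(w - 1) + v_M(k)` for
  `w ≡ 1 (mod M^{depth})`, and its consequences `pow_pow_eq_one_of_congOne`,
  `congOne_of_pow_pow_eq_one` for units `≡ 1 (mod M^j)`.
* `tamePart` — the projection `u ↦ v` onto `V` (`u^{M^{m-1}}`, resp. `±1 ≡ u (mod 4)`), with
  `u v⁻¹ ≡ 1 (mod M^{depth})` (`congOne_mul_tamePart_inv`); `V ∩ U = 1` (`eq_one_of_isTors_of_congOne`).
* `exists_unique_decomp` — **`(ℤ/M^m)ˣ ⊇ {u : u^{M^{m-j}} ∈ V} = V · K_j` with unique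
  decomposition** (`depth ≤ j ≤ m`), the finite shadow of `ℤ_Mˣ = V × U`.

## References

* W. Sinnott, *On a theorem of L. Washington*, Astérisque 147–148 (1987), 209–224, §1.1, §3.
  [Sinnott1987]
-/

noncomputable section

open Finset

namespace Literature.NumberTheory.LFunctions.Sinnott1987

variable {M : ℕ} [hM : Fact M.Prime]

/-! ### Lifting the exponent for `w ≡ 1 (mod M)` (`mod 4`) and a general exponent -/

section LTE

/-- `depth M = 2` for `M = 2` and `1` otherwise: `U = 1 + M^{depth M} ℤ_M`.
[cite: Sinnott1987, §1.1] -/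
def depth (M : ℕ) : ℕ := if M = 2 then 2 else 1

/-- `1 ≤ depth M`. [folklore] -/
theorem one_le_depth (M : ℕ) : 1 ≤ depth M := by
  unfold depth; split_ifs <;> omega

/-- `depth M ≤ 2`. [folklore] -/
theorem depth_le_two (M : ℕ) : depth M ≤ 2 := by
  unfold depth; split_ifs <;> omega

omit hM in
/-- `M^{depth M}` is `4` for `M = 2` and `M` otherwise. [folklore] -/
theorem pow_depth_eq : M ^ depth M = if M = 2 then 4 else M := by
  unfold depth; split_ifs with h <;> simp [h]

omit hM in
/-- A natural number `w > 1` with `w ≡ 1 (mod M^{depth M})` satisfies `GoodModulus M w`. [folklore] -/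
theorem goodModulus_of_modEq {w : ℕ} (hw : 1 < w) (h : w ≡ 1 [MOD M ^ depth M]) :
    GoodModulus M w := by
  have h' : M ^ depth M ∣ w - 1 := (Nat.modEq_iff_dvd' hw.le).mp h.symm
  refine ⟨hw, ?_, fun h2 ↦ ?_⟩
  · exact dvd_trans (dvd_pow_self M (by have := one_le_depth M; omega)) h'
  · have : M ^ depth M = 4 := by rw [pow_depth_eq, if_pos h2]
    rwa [this] at h'

/-- **Lifting the exponent with a general exponent**: for `GoodModulus M w` and `k ≠ 0`,
`v_M(w^k - 1) = v_M(w - 1) + v_M(k)`. [folklore] -/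
theorem padicValNat_pow_sub_one {w : ℕ} (hw : GoodModulus M w) {k : ℕ} (hk : k ≠ 0) :
    padicValNat M (w ^ k - 1) = padicValNat M (w - 1) + padicValNat M k := by
  have hMp := hM.out
  have hw1 := hw.one_lt
  have hMw : ¬ M ∣ w := hw.not_dvd
  rcases hMp.eq_two_or_odd' with h2 | hodd
  · subst h2
    have h4 : 4 ∣ w - 1 := hw.four_dvd rfl
    rcases Nat.even_or_odd k with heven | hkodd
    · have h := padicValNat.pow_two_sub_one hw1 hMw hk heven
      have hq1' : padicValNat 2 (w + 1) = 1 := by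
        obtain ⟨c, hc⟩ := h4
        have hq' : w + 1 = 2 * (2 * c + 1) := by omega
        rw [hq', padicValNat.mul (by norm_num) (by omega), padicValNat.self (by norm_num),
          padicValNat.eq_zero_of_not_dvd (by omega)]
      omega
    · -- odd exponent: `w^k - 1 = (w - 1) · ∑_{i<k} w^i` with an odd second factor
      have hgeom : w ^ k - 1 = (w - 1) * ∑ i ∈ range k, w ^ i := by
        have := geom_sum_mul_add (w - 1) k
        rw [Nat.sub_add_cancel hw1.le] at this
        rw [← this, Nat.add_sub_cancel, mul_comm]
      have hSodd : ¬ 2 ∣ ∑ i ∈ range k, w ^ i := by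
        rw [Nat.dvd_iff_mod_eq_zero, Finset.sum_nat_mod]
        have : ∀ i ∈ range k, w ^ i % 2 = 1 := by
          intro i _
          have : w % 2 = 1 := by omega
          simp [Nat.pow_mod, this]
        rw [sum_congr rfl this, sum_const, card_range, smul_eq_mul, mul_one]
        rw [Nat.odd_iff.mp hkodd]; omega
      have hS0 : ∑ i ∈ range k, w ^ i ≠ 0 := fun h ↦ hSodd (h ▸ dvd_zero 2)
      rw [hgeom, padicValNat.mul (by omega) hS0, padicValNat.eq_zero_of_not_dvd hSodd,
        padicValNat.eq_zero_of_not_dvd (fun h ↦ (Nat.not_even_iff_odd.mpr hkodd)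
          (even_iff_two_dvd.mpr h))]
  · have h := padicValNat.pow_sub_pow (p := M) hodd hw1 (by simpa using hw.dvd) hMw hk
    simpa using h

end LTE

/-! ### Units `≡ 1 (mod M^j)`: the subgroups `K_j` -/

section CongOne

variable {m : ℕ}

/-- `M^m ≠ 0`. [folklore] -/
instance neZero_pow (m : ℕ) : NeZero (M ^ m) := ⟨pow_ne_zero _ hM.out.ne_zero⟩

/-- "`u ≡ 1 (mod M^j)`" for `u ∈ ℤ/M^m`, on the canonical representative. [folklore] -/
def CongOne (j : ℕ) (u : ZMod (M ^ m)) : Prop := u.val ≡ 1 [MOD M ^ j]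

omit hM in
/-- `CongOne` is decidable. [folklore] -/
instance decidableCongOne (j : ℕ) (u : ZMod (M ^ m)) : Decidable (CongOne j u) :=
  inferInstanceAs (Decidable (u.val ≡ 1 [MOD M ^ j]))

omit hM in
/-- Unfolding `CongOne`. [folklore] -/
theorem congOne_iff (j : ℕ) (u : ZMod (M ^ m)) : CongOne j u ↔ u.val ≡ 1 [MOD M ^ j] := Iff.rfl

/-- `1 ≡ 1 (mod M^j)`. [folklore] -/
theorem congOne_one (j : ℕ) (hm : 1 ≤ m) : CongOne j ((1 : (ZMod (M ^ m))ˣ) : ZMod (M ^ m)) := by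
  have : Fact (1 < M ^ m) := ⟨Nat.one_lt_pow (by omega) hM.out.one_lt⟩
  rw [congOne_iff, Units.val_one, ZMod.val_one]

omit hM in
/-- `CongOne` is monotone in the exponent. [folklore] -/
theorem CongOne.mono {j j' : ℕ} (h : j' ≤ j) {u : ZMod (M ^ m)} (hu : CongOne j u) : CongOne j' u :=
  Nat.ModEq.of_dvd (pow_dvd_pow M h) hu

/-- The unit `1 + M^j k` of `ℤ/M^m` (for `j ≥ 1`; by definition the value is `1 + M·M^{j-1}·k`).
[cite: Sinnott1987, §3 (the groups `1 + p^n ℤ_p`)] -/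
def unitOneAdd (m j k : ℕ) : (ZMod (M ^ m))ˣ :=
  ZMod.unitOfCoprime (1 + M * (M ^ (j - 1) * k))
    (Nat.Coprime.pow_right _ ((Nat.coprime_add_mul_left_left 1 M _).mpr (Nat.coprime_one_left M)))

omit hM in
/-- The underlying residue class of `unitOneAdd m j k` is `1 + M^j k`. [folklore] -/
theorem coe_unitOneAdd {j : ℕ} (hj : 1 ≤ j) (k : ℕ) :
    ((unitOneAdd m j k : (ZMod (M ^ m))ˣ) : ZMod (M ^ m)) = ((1 + M ^ j * k : ℕ) : ZMod (M ^ m)) := by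
  rw [unitOneAdd, ZMod.coe_unitOfCoprime]
  congr 2
  rw [← mul_assoc, ← pow_succ', Nat.sub_add_cancel hj]

/-- `1 + M^j k < M^m` for `1 ≤ j ≤ m` and `k < M^{m-j}`. [folklore] -/
theorem one_add_pow_mul_lt {j k : ℕ} (hj : 1 ≤ j) (hjm : j ≤ m) (hk : k < M ^ (m - j)) :
    1 + M ^ j * k < M ^ m := by
  have h1 : M ^ j * (k + 1) ≤ M ^ j * M ^ (m - j) := Nat.mul_le_mul_left _ hk
  rw [← pow_add, Nat.add_sub_cancel' hjm, mul_add, mul_one] at h1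
  have h2 : 2 ≤ M ^ j := le_trans hM.out.two_le (Nat.le_self_pow (by omega) M)
  omega

/-- The representative of `unitOneAdd m j k` is `1 + M^j k` (`k < M^{m-j}`). [folklore] -/
theorem val_unitOneAdd {j k : ℕ} (hj : 1 ≤ j) (hjm : j ≤ m) (hk : k < M ^ (m - j)) :
    ((unitOneAdd m j k : (ZMod (M ^ m))ˣ) : ZMod (M ^ m)).val = 1 + M ^ j * k := by
  rw [coe_unitOneAdd hj, ZMod.val_cast_of_lt (one_add_pow_mul_lt hj hjm hk)]

/-- `unitOneAdd m j k ≡ 1 (mod M^j)`. [folklore] -/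
theorem congOne_unitOneAdd {j k : ℕ} (hj : 1 ≤ j) (hjm : j ≤ m) (hk : k < M ^ (m - j)) :
    CongOne j ((unitOneAdd m j k : (ZMod (M ^ m))ˣ) : ZMod (M ^ m)) := by
  rw [congOne_iff, val_unitOneAdd hj hjm hk]
  show (1 + M ^ j * k) % M ^ j = 1 % M ^ j
  rw [Nat.add_mul_mod_self_left]

/-- `k ↦ unitOneAdd m j k` is injective on `k < M^{m-j}`. [folklore] -/
theorem unitOneAdd_injective {j : ℕ} (hj : 1 ≤ j) (hjm : j ≤ m) {k k' : ℕ} (hk : k < M ^ (m - j))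
    (hk' : k' < M ^ (m - j)) (h : (unitOneAdd m j k : (ZMod (M ^ m))ˣ) = unitOneAdd m j k') :
    k = k' := by
  have := congrArg (fun u : (ZMod (M ^ m))ˣ ↦ (u : ZMod (M ^ m)).val) h
  simp only [val_unitOneAdd hj hjm hk, val_unitOneAdd hj hjm hk'] at this
  have hpos : 0 < M ^ j := pow_pos hM.out.pos _
  exact Nat.eq_of_mul_eq_mul_left hpos (by omega)

/-- **The units `≡ 1 (mod M^j)` are exactly the `1 + M^j k`, `k < M^{m-j}`** (`1 ≤ j ≤ m`).
[cite: Sinnott1987, §3] -/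
theorem congOne_iff_exists {j : ℕ} (hj : 1 ≤ j) (hjm : j ≤ m) (u : (ZMod (M ^ m))ˣ) :
    CongOne j (u : ZMod (M ^ m)) ↔ ∃ k, k < M ^ (m - j) ∧ u = unitOneAdd m j k := by
  constructor
  · intro hu
    have h1 : 1 < M ^ j := Nat.one_lt_pow (by omega) hM.out.one_lt
    have hmod : (u : ZMod (M ^ m)).val % M ^ j = 1 := by
      rw [hu]; exact Nat.mod_eq_of_lt h1
    have hval : (u : ZMod (M ^ m)).val = 1 + M ^ j * ((u : ZMod (M ^ m)).val / M ^ j) := by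
      have := Nat.div_add_mod ((u : ZMod (M ^ m)).val) (M ^ j)
      rw [hmod] at this; omega
    have hklt : (u : ZMod (M ^ m)).val / M ^ j < M ^ (m - j) := by
      rw [Nat.div_lt_iff_lt_mul (pow_pos hM.out.pos _), ← pow_add, Nat.sub_add_cancel hjm]
      exact ZMod.val_lt _
    refine ⟨(u : ZMod (M ^ m)).val / M ^ j, hklt, ?_⟩
    ext
    apply ZMod.val_injective
    rw [val_unitOneAdd hj hjm hklt]; exact hval
  · rintro ⟨k, hk, rfl⟩
    exact congOne_unitOneAdd hj hjm hk

/-- Sums over the units `≡ 1 (mod M^j)` are sums over `k < M^{m-j}`. [folklore] -/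
theorem sum_filter_congOne_eq {β : Type*} [AddCommMonoid β] {j : ℕ} (hj : 1 ≤ j) (hjm : j ≤ m)
    (f : (ZMod (M ^ m))ˣ → β) :
    ∑ u ∈ univ.filter (fun u : (ZMod (M ^ m))ˣ ↦ CongOne j (u : ZMod (M ^ m))), f u =
      ∑ k ∈ range (M ^ (m - j)), f (unitOneAdd m j k) := by
  classical
  symm
  refine Finset.sum_nbij (fun k ↦ unitOneAdd m j k) (fun k hk ↦ ?_) (fun k hk k' hk' h ↦ ?_)
    (fun u hu ↦ ?_) (fun _ _ ↦ rfl)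
  · rw [mem_range] at hk
    exact mem_filter.mpr ⟨mem_univ _, congOne_unitOneAdd hj hjm hk⟩
  · rw [mem_coe, mem_range] at hk hk'
    exact unitOneAdd_injective hj hjm hk hk' h
  · rw [mem_coe, mem_filter] at hu
    obtain ⟨k, hk, rfl⟩ := (congOne_iff_exists hj hjm u).mp hu.2
    exact ⟨k, by rw [mem_coe, mem_range]; exact hk, rfl⟩

/-- The number of units `≡ 1 (mod M^j)` is `M^{m-j}`. [folklore] -/
theorem card_filter_congOne {j : ℕ} (hj : 1 ≤ j) (hjm : j ≤ m) :
    (univ.filter (fun u : (ZMod (M ^ m))ˣ ↦ CongOne j (u : ZMod (M ^ m)))).card = M ^ (m - j) := by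
  classical
  have := sum_filter_congOne_eq (m := m) hj hjm (fun _ : (ZMod (M ^ m))ˣ ↦ (1 : ℕ))
  simpa using this

omit hM in
/-- `CongOne j` is multiplicative. [folklore] -/
theorem CongOne.mul {j : ℕ} (hjm : j ≤ m) {u v : ZMod (M ^ m)} (hu : CongOne j u) (hv : CongOne j v) :
    CongOne j (u * v) := by
  rw [congOne_iff, ZMod.val_mul]
  have h : M ^ j ∣ M ^ m := pow_dvd_pow M hjm
  calc u.val * v.val % M ^ m ≡ u.val * v.val [MOD M ^ j] := (Nat.mod_modEq _ _).of_dvd h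
    _ ≡ 1 * 1 [MOD M ^ j] := Nat.ModEq.mul hu hv

/-- `CongOne j` is stable under powers. [folklore] -/
theorem CongOne.pow {j : ℕ} (hjm : j ≤ m) (hm : 1 ≤ m) {u : ZMod (M ^ m)} (hu : CongOne j u) (k : ℕ) :
    CongOne j (u ^ k) := by
  induction k with
  | zero =>
    have : Fact (1 < M ^ m) := ⟨Nat.one_lt_pow (by omega) hM.out.one_lt⟩
    rw [pow_zero, congOne_iff, ZMod.val_one]
  | succ k ih => rw [pow_succ]; exact ih.mul hjm hu

/-- `CongOne j` is stable under inversion of units. [folklore] -/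
theorem CongOne.inv {j : ℕ} (hjm : j ≤ m) (hm : 1 ≤ m) {u : (ZMod (M ^ m))ˣ}
    (hu : CongOne j (u : ZMod (M ^ m))) : CongOne j ((u⁻¹ : (ZMod (M ^ m))ˣ) : ZMod (M ^ m)) := by
  -- `u⁻¹ = u^{φ(M^m) - 1}`
  have htot : u ^ Nat.totient (M ^ m) = 1 := ZMod.pow_totient u
  have hpos : 1 ≤ Nat.totient (M ^ m) := Nat.totient_pos.mpr (pow_pos hM.out.pos _)
  have : u⁻¹ = u ^ (Nat.totient (M ^ m) - 1) := by
    rw [eq_comm, ← mul_eq_one_iff_eq_inv (a := u ^ _), ← pow_succ, Nat.sub_add_cancel hpos, htot]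
  rw [this, Units.val_pow_eq_pow_val]
  exact hu.pow hjm hm _

omit hM in
/-- **`(1 + M^j)^k = 1 + k M^j` in `ℤ/M^m` when `2j ≥ m`**: the units `≡ 1 (mod M^j)` form the
cyclic group generated by `1 + M^j`. [cite: Sinnott1987, proof of Lemma 3.6, (3.8)] -/
theorem unitOneAdd_one_pow {j : ℕ} (hj : 1 ≤ j) (h2j : m ≤ 2 * j) (k : ℕ) :
    (unitOneAdd m j 1 : (ZMod (M ^ m))ˣ) ^ k = unitOneAdd m j k := by
  ext
  rw [Units.val_pow_eq_pow_val, coe_unitOneAdd hj, coe_unitOneAdd hj]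
  have hz : (M : ZMod (M ^ m)) ^ j * (M : ZMod (M ^ m)) ^ j = 0 := by
    rw [← pow_add, ← Nat.cast_pow, ZMod.natCast_eq_zero_iff]
    exact pow_dvd_pow M (by omega)
  induction k with
  | zero => simp
  | succ k ih =>
    rw [pow_succ, ih]
    push_cast
    linear_combination (k : ZMod (M ^ m)) * hz

/-- **Partition of `K_{j'}` into the cosets `g^i K_j`, `i < M^{j-j'}`**, for a unit `g ≡ 1 (mod M^{j'})`
no power `g^i`, `0 < i < M^{j-j'}`, of which is `≡ 1 (mod M^j)` (`1 ≤ j' ≤ j ≤ m`).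
[cite: Sinnott1987, proof of Lemma 3.6 (summation over `(1 + p^{n₀}ℤ_p)/(1 + p^n ℤ_p)`)] -/
theorem sum_filter_congOne_eq_sum_sum {β : Type*} [AddCommMonoid β] {j j' : ℕ} (hj' : 1 ≤ j')
    (hjj : j' ≤ j) (hjm : j ≤ m) {g : (ZMod (M ^ m))ˣ} (hg : CongOne j' (g : ZMod (M ^ m)))
    (hord : ∀ i, 0 < i → i < M ^ (j - j') → ¬ CongOne j ((g ^ i : (ZMod (M ^ m))ˣ) : ZMod (M ^ m)))
    (f : (ZMod (M ^ m))ˣ → β) :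
    ∑ t ∈ univ.filter (fun t : (ZMod (M ^ m))ˣ ↦ CongOne j' (t : ZMod (M ^ m))), f t =
      ∑ i ∈ range (M ^ (j - j')),
        ∑ w ∈ univ.filter (fun w : (ZMod (M ^ m))ˣ ↦ CongOne j (w : ZMod (M ^ m))), f (g ^ i * w) := by
  classical
  have hm : 1 ≤ m ∨ m = 0 := by omega
  rcases hm with hm | rfl
  swap
  · -- `m = 0`: everything is the trivial group
    have hj0 : j = 0 := by omega
    omega
  set Kj := univ.filter (fun w : (ZMod (M ^ m))ˣ ↦ CongOne j (w : ZMod (M ^ m))) with hKj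
  set Kj' := univ.filter (fun t : (ZMod (M ^ m))ˣ ↦ CongOne j' (t : ZMod (M ^ m))) with hKj'
  set S := (range (M ^ (j - j'))) ×ˢ Kj with hS
  have hmapsto : ∀ x ∈ S, (g ^ x.1 * x.2) ∈ Kj' := by
    rintro ⟨i, w⟩ hx
    rw [hS, mem_product, mem_range, hKj, mem_filter] at hx
    rw [hKj', mem_filter, Units.val_mul, Units.val_pow_eq_pow_val]
    exact ⟨mem_univ _, (hg.pow (le_trans hjj hjm) hm _).mul (le_trans hjj hjm) (hx.2.2.mono hjj)⟩
  have hinj : Set.InjOn (fun x : ℕ × (ZMod (M ^ m))ˣ ↦ g ^ x.1 * x.2) S := by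
    rintro ⟨i, w⟩ hx ⟨i', w'⟩ hx' h
    simp only [hS, coe_product, Set.mem_prod, mem_coe, mem_range, hKj, mem_filter] at hx hx'
    simp only at h
    -- `g^{|i - i'|} ∈ K_j` forces `i = i'`
    have key : ∀ {a b : ℕ} {u u' : (ZMod (M ^ m))ˣ}, b < M ^ (j - j') → CongOne j (u : ZMod (M ^ m)) →
        CongOne j (u' : ZMod (M ^ m)) → g ^ a * u = g ^ b * u' → a < b → False := by
      intro a b u u' hb hu hu' hab hlt
      have hb : g ^ (b - a) = u * u'⁻¹ := by
        rw [eq_mul_inv_iff_mul_eq, ← mul_left_cancel_iff (a := g ^ a), ← mul_assoc, ← pow_add,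
          Nat.add_sub_cancel' hlt.le, hab]
      refine hord (b - a) (by omega) (by omega) ?_
      rw [hb, Units.val_mul]
      exact hu.mul hjm (hu'.inv hjm hm)
    rcases lt_trichotomy i i' with hlt | rfl | hgt
    · exact (key hx'.1 hx.2.2 hx'.2.2 h hlt).elim
    · exact Prod.ext rfl (mul_left_cancel h)
    · exact (key hx.1 hx'.2.2 hx.2.2 h.symm hgt).elim
  have himage : S.image (fun x ↦ g ^ x.1 * x.2) = Kj' := by
    refine eq_of_subset_of_card_le (fun u hu ↦ ?_) ?_
    · rw [mem_image] at hu
      obtain ⟨x, hx, rfl⟩ := hu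
      exact hmapsto x hx
    · rw [card_image_of_injOn hinj, hS, card_product, card_range, hKj, hKj',
        card_filter_congOne hj' (le_trans hjj hjm), card_filter_congOne (le_trans hj' hjj) hjm,
        ← pow_add]
      apply le_of_eq; congr 1; omega
  rw [← himage, sum_image hinj, hS, sum_product]

end CongOne

/-! ### Lifting the exponent for units `≡ 1 (mod M^j)` -/

section UnitLTE

variable {m : ℕ}

/-- A unit `u ≡ 1 (mod M^j)` with `depth M ≤ j` and `u ≠ 1` has a representative satisfying
`GoodModulus`. [folklore] -/
theorem goodModulus_val {j : ℕ} (hj : depth M ≤ j) {u : (ZMod (M ^ m))ˣ}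
    (hu : CongOne j (u : ZMod (M ^ m))) (hne : (u : ZMod (M ^ m)).val ≠ 1) (hm : 1 ≤ m) :
    GoodModulus M (u : ZMod (M ^ m)).val := by
  have h0 : (u : ZMod (M ^ m)).val ≠ 0 := by
    intro h
    have : (u : ZMod (M ^ m)) = 0 := (ZMod.val_eq_zero _).mp h
    have h1 : Fact (1 < M ^ m) := ⟨Nat.one_lt_pow (by omega) hM.out.one_lt⟩
    exact (Units.ne_zero u) this
  exact goodModulus_of_modEq (by omega) (hu.mono hj)

/-- The representative of a unit is positive (`m ≥ 1`). [folklore] -/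
theorem val_units_pos (hm : 1 ≤ m) (u : (ZMod (M ^ m))ˣ) : 0 < (u : ZMod (M ^ m)).val := by
  rcases Nat.eq_zero_or_pos (u : ZMod (M ^ m)).val with h | h
  · exfalso
    have : Fact (1 < M ^ m) := ⟨Nat.one_lt_pow (by omega) hM.out.one_lt⟩
    exact (Units.ne_zero u) ((ZMod.val_eq_zero _).mp h)
  · exact h

/-- `u^k = 1` in `ℤ/M^m` iff `M^m ∣ ũ^k - 1` for the representative `ũ`. [folklore] -/
theorem units_pow_eq_one_iff_dvd (hm : 1 ≤ m) (u : (ZMod (M ^ m))ˣ) (k : ℕ) :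
    u ^ k = 1 ↔ M ^ m ∣ (u : ZMod (M ^ m)).val ^ k - 1 := by
  have h1 : 1 ≤ (u : ZMod (M ^ m)).val ^ k := Nat.one_le_pow _ _ (val_units_pos hm u)
  rw [Units.ext_iff, Units.val_pow_eq_pow_val, Units.val_one]
  conv_lhs => rw [← ZMod.natCast_zmod_val (u : ZMod (M ^ m)), ← Nat.cast_pow, ← Nat.cast_one,
    ZMod.natCast_eq_natCast_iff]
  exact ⟨fun h ↦ (Nat.modEq_iff_dvd' h1).mp h.symm, fun h ↦ ((Nat.modEq_iff_dvd' h1).mpr h).symm⟩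

/-- **`u ≡ 1 (mod M^j)`, `depth M ≤ j`, `j + i ≥ m` ⟹ `u^{M^i} = 1`.** [folklore] -/
theorem pow_pow_eq_one_of_congOne {j i : ℕ} (hj : depth M ≤ j) (hm : 1 ≤ m) (hji : m ≤ j + i)
    {u : (ZMod (M ^ m))ˣ} (hu : CongOne j (u : ZMod (M ^ m))) : u ^ M ^ i = 1 := by
  rw [units_pow_eq_one_iff_dvd hm]
  by_cases hne : (u : ZMod (M ^ m)).val = 1
  · rw [hne, one_pow, Nat.sub_self]; exact dvd_zero _
  have hgood := goodModulus_val hj hu hne hm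
  have hpos : (u : ZMod (M ^ m)).val ^ M ^ i - 1 ≠ 0 := by
    have := Nat.one_lt_pow (n := M ^ i) (pow_ne_zero i hM.out.ne_zero) hgood.one_lt; omega
  rw [padicValNat_dvd_iff_le hpos, padicValNat_pow_pow_sub_one hgood]
  have hv : j ≤ padicValNat M ((u : ZMod (M ^ m)).val - 1) := by
    have h0 : (u : ZMod (M ^ m)).val - 1 ≠ 0 := by have := hgood.one_lt; omega
    rw [← padicValNat_dvd_iff_le h0]
    exact (Nat.modEq_iff_dvd' hgood.one_lt.le).mp hu.symm
  omega

/-- **`u ≡ 1 (mod M^{depth})`, `u^{M^i} = 1`, `i ≤ m` ⟹ `u ≡ 1 (mod M^{m-i})`** (exact lifting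
of the exponent). [folklore] -/
theorem congOne_of_pow_pow_eq_one {i : ℕ} (hm : 1 ≤ m) (him : i ≤ m) {u : (ZMod (M ^ m))ˣ}
    (hu : CongOne (depth M) (u : ZMod (M ^ m))) (hpow : u ^ M ^ i = 1) :
    CongOne (m - i) (u : ZMod (M ^ m)) := by
  by_cases hne : (u : ZMod (M ^ m)).val = 1
  · rw [congOne_iff, hne]
  have hgood := goodModulus_val le_rfl hu hne hm
  rw [units_pow_eq_one_iff_dvd hm] at hpow
  have hpos : (u : ZMod (M ^ m)).val ^ M ^ i - 1 ≠ 0 := by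
    have := Nat.one_lt_pow (n := M ^ i) (pow_ne_zero i hM.out.ne_zero) hgood.one_lt; omega
  rw [padicValNat_dvd_iff_le hpos, padicValNat_pow_pow_sub_one hgood] at hpow
  have h0 : (u : ZMod (M ^ m)).val - 1 ≠ 0 := by have := hgood.one_lt; omega
  have hv : m - i ≤ padicValNat M ((u : ZMod (M ^ m)).val - 1) := by omega
  rw [← padicValNat_dvd_iff_le h0] at hv
  exact ((Nat.modEq_iff_dvd' hgood.one_lt.le).mpr hv).symm

/-- In particular `u ≡ 1 (mod M^{depth})` and `u^k = 1` with `M ∤ k`... we only need: `u ≡ 1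
(mod M^{depth})` and `u^{k} = 1` for `k` coprime to `M` force `u = 1`. [folklore] -/
theorem eq_one_of_congOne_of_pow_eq_one {k : ℕ} (hm : 1 ≤ m) (hk : ¬ M ∣ k) (hk0 : k ≠ 0)
    {u : (ZMod (M ^ m))ˣ} (hu : CongOne (depth M) (u : ZMod (M ^ m))) (hpow : u ^ k = 1) :
    u = 1 := by
  by_contra hne1
  have hne : (u : ZMod (M ^ m)).val ≠ 1 := by
    intro h
    apply hne1
    ext; apply ZMod.val_injective
    have : Fact (1 < M ^ m) := ⟨Nat.one_lt_pow (by omega) hM.out.one_lt⟩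
    rw [h, Units.val_one, ZMod.val_one]
  have hgood := goodModulus_val le_rfl hu hne hm
  rw [units_pow_eq_one_iff_dvd hm] at hpow
  have hpos : (u : ZMod (M ^ m)).val ^ k - 1 ≠ 0 := by
    have := Nat.one_lt_pow hk0 hgood.one_lt; omega
  rw [padicValNat_dvd_iff_le hpos, padicValNat_pow_sub_one hgood hk0,
    padicValNat.eq_zero_of_not_dvd hk, add_zero] at hpow
  have h0 : (u : ZMod (M ^ m)).val - 1 ≠ 0 := by have := hgood.one_lt; omega
  rw [← padicValNat_dvd_iff_le h0] at hpow
  have hlt : (u : ZMod (M ^ m)).val - 1 < M ^ m := by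
    have := ZMod.val_lt (u : ZMod (M ^ m)); omega
  have := Nat.eq_zero_of_dvd_of_lt hpow hlt
  omega

end UnitLTE

/-! ### The torsion `V` and the projection onto it -/

section Tors

variable {m : ℕ}

/-- "`u ∈ V`": `u^{M-1} = 1` for odd `M`, `u ∈ {1, -1}` for `M = 2` (the image of the torsion of
`ℤ_Mˣ`). [cite: Sinnott1987, §1.1] -/
def IsTors (u : (ZMod (M ^ m))ˣ) : Prop :=
  (M = 2 ∧ (u = 1 ∨ u = -1)) ∨ (M ≠ 2 ∧ u ^ (M - 1) = 1)

omit hM in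
/-- `IsTors` is decidable. [folklore] -/
instance decidableIsTors (u : (ZMod (M ^ m))ˣ) : Decidable (IsTors u) := by
  unfold IsTors; infer_instance

omit hM in
/-- `1 ∈ V`. [folklore] -/
theorem isTors_one : IsTors (1 : (ZMod (M ^ m))ˣ) := by
  unfold IsTors
  by_cases h : M = 2
  · exact Or.inl ⟨h, Or.inl rfl⟩
  · exact Or.inr ⟨h, one_pow _⟩

omit hM in
/-- `V` is closed under multiplication. [folklore] -/
theorem IsTors.mul {u v : (ZMod (M ^ m))ˣ} (hu : IsTors u) (hv : IsTors v) : IsTors (u * v) := by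
  unfold IsTors at *
  rcases hu with ⟨h2, hu⟩ | ⟨h2, hu⟩
  · rcases hv with ⟨_, hv⟩ | ⟨h2', _⟩
    · left; refine ⟨h2, ?_⟩
      rcases hu with rfl | rfl <;> rcases hv with rfl | rfl <;> simp
    · exact absurd h2 h2'
  · rcases hv with ⟨h2', _⟩ | ⟨_, hv⟩
    · exact absurd h2' h2
    · right; exact ⟨h2, by rw [mul_pow, hu, hv, one_mul]⟩

omit hM in
/-- `V` is closed under inversion. [folklore] -/
theorem IsTors.inv {u : (ZMod (M ^ m))ˣ} (hu : IsTors u) : IsTors u⁻¹ := by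
  unfold IsTors at *
  rcases hu with ⟨h2, hu⟩ | ⟨h2, hu⟩
  · left; refine ⟨h2, ?_⟩
    rcases hu with rfl | rfl <;> simp
  · right; exact ⟨h2, by rw [inv_pow, hu, inv_one]⟩

omit hM in
/-- `V` is closed under powers. [folklore] -/
theorem IsTors.pow {u : (ZMod (M ^ m))ˣ} (hu : IsTors u) (k : ℕ) : IsTors (u ^ k) := by
  induction k with
  | zero => rw [pow_zero]; exact isTors_one
  | succ k ih => rw [pow_succ]; exact ih.mul hu

/-- `-1 ∈ V`. [folklore] -/
theorem isTors_neg_one : IsTors (-1 : (ZMod (M ^ m))ˣ) := by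
  unfold IsTors
  by_cases h : M = 2
  · exact Or.inl ⟨h, Or.inr rfl⟩
  · right; refine ⟨h, ?_⟩
    obtain ⟨k, hk⟩ : Even (M - 1) := hM.out.even_sub_one h
    rw [hk, ← two_mul, pow_mul, neg_one_sq, one_pow]

/-- Every unit raised to the power `M^m` lands in `V` (its `U`-component dies). [folklore] -/
theorem isTors_pow_pow (hm : 1 ≤ m) (u : (ZMod (M ^ m))ˣ) : IsTors (u ^ M ^ m) := by
  unfold IsTors
  by_cases h2 : M = 2
  · left; refine ⟨h2, Or.inl ?_⟩
    have htot : u ^ Nat.totient (M ^ m) = 1 := ZMod.pow_totient u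
    rw [Nat.totient_prime_pow hM.out (by omega)] at htot
    have hexp : M ^ (m - 1) * (M - 1) * M = M ^ m := by
      rw [h2, show (2:ℕ) - 1 = 1 from rfl, mul_one, ← pow_succ, Nat.sub_add_cancel hm]
    calc u ^ M ^ m = (u ^ (M ^ (m - 1) * (M - 1))) ^ M := by rw [← pow_mul, hexp]
      _ = 1 := by rw [htot, one_pow]
  · right; refine ⟨h2, ?_⟩
    rw [← pow_mul]
    have : M ^ m * (M - 1) = Nat.totient (M ^ m) * M := by
      rw [Nat.totient_prime_pow hM.out (by omega)]
      rw [show M ^ m = M ^ (m - 1) * M by rw [← pow_succ, Nat.sub_add_cancel hm]]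
      ring
    rw [this, pow_mul, ZMod.pow_totient, one_pow]

/-- `CongOne j w` iff the reduction of `w` modulo `M^j` is `1`. [folklore] -/
theorem congOne_iff_castHom {j : ℕ} (hjm : j ≤ m) (w : ZMod (M ^ m)) :
    CongOne j w ↔ ZMod.castHom (pow_dvd_pow M hjm) (ZMod (M ^ j)) w = 1 := by
  rw [ZMod.castHom_apply, ZMod.cast_eq_val, congOne_iff,
    show (1 : ZMod (M ^ j)) = ((1 : ℕ) : ZMod (M ^ j)) by rw [Nat.cast_one],
    ZMod.natCast_eq_natCast_iff]

/-- The projection `u ↦ v` of a unit onto `V`: `u^{M^{m-1}}` for odd `M`, the element of `{±1}`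
congruent to `u` modulo `4` for `M = 2`. [cite: Sinnott1987, §1.1 (`ℤ_pˣ = V × U`)] -/
def tamePart (u : (ZMod (M ^ m))ˣ) : (ZMod (M ^ m))ˣ :=
  if M = 2 then (if (u : ZMod (M ^ m)).val % 4 = 1 then 1 else -1) else u ^ M ^ (m - 1)

/-- `tamePart u ∈ V`. [folklore] -/
theorem isTors_tamePart (hm : 1 ≤ m) (u : (ZMod (M ^ m))ˣ) : IsTors (tamePart u) := by
  unfold tamePart
  by_cases h2 : M = 2
  · rw [if_pos h2]
    split_ifs
    · exact isTors_one
    · exact isTors_neg_one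
  · rw [if_neg h2]
    unfold IsTors
    right; refine ⟨h2, ?_⟩
    rw [← pow_mul]
    have : M ^ (m - 1) * (M - 1) = Nat.totient (M ^ m) := by
      rw [Nat.totient_prime_pow hM.out (by omega)]
    rw [this, ZMod.pow_totient]

/-- `u · (u^{M^{m-1}})⁻¹ ≡ 1 (mod M)` (Fermat). [folklore] -/
theorem congOne_mul_pow_inv (hm : 1 ≤ m) (u : (ZMod (M ^ m))ˣ) :
    CongOne 1 ((u * (u ^ M ^ (m - 1))⁻¹ : (ZMod (M ^ m))ˣ) : ZMod (M ^ m)) := by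
  have h1m : 1 ≤ m := hm
  rw [congOne_iff_castHom h1m]
  set φ := ZMod.castHom (pow_dvd_pow M h1m) (ZMod (M ^ 1)) with hφ
  have key : ∀ w : (ZMod (M ^ m))ˣ, φ (w : ZMod (M ^ m)) = ((Units.map φ.toMonoidHom w : (ZMod (M ^ 1))ˣ) : ZMod (M ^ 1)) :=
    fun w ↦ rfl
  rw [key, map_mul, map_inv, map_pow]
  set ub := Units.map φ.toMonoidHom u with hub
  have hF : ub ^ M ^ (m - 1) = ub := by
    ext
    rw [Units.val_pow_eq_pow_val]
    have : Fact (Nat.Prime (M ^ 1)) := ⟨by rw [pow_one]; exact hM.out⟩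
    have hc := ZMod.pow_card_pow (p := M ^ 1) (n := m - 1) (ub : ZMod (M ^ 1))
    have h11 : (M ^ 1) ^ (m - 1) = M ^ (m - 1) := by rw [pow_one]
    rwa [h11] at hc
  rw [hF, mul_inv_cancel, Units.val_one]

/-- **`u · (tamePart u)⁻¹ ∈ U`**, i.e. `≡ 1 (mod M^{depth M})` (`depth M ≤ m`).
[cite: Sinnott1987, §1.1] -/
theorem congOne_mul_tamePart_inv (hm : depth M ≤ m) (u : (ZMod (M ^ m))ˣ) :
    CongOne (depth M) ((u * (tamePart u)⁻¹ : (ZMod (M ^ m))ˣ) : ZMod (M ^ m)) := by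
  have hm1 : 1 ≤ m := le_trans (one_le_depth M) hm
  by_cases h2 : M = 2
  · subst h2
    have hm2 : 2 ≤ m := by unfold depth at hm; rwa [if_pos rfl] at hm
    have h4 : 4 ∣ 2 ^ m := dvd_trans (by norm_num : 4 ∣ 2 ^ 2) (pow_dvd_pow 2 hm2)
    obtain ⟨t, ht⟩ := h4
    have h1lt : Fact (1 < 2 ^ m) := ⟨Nat.one_lt_pow (by omega) (by norm_num)⟩
    have hodd : (u : ZMod (2 ^ m)).val % 2 = 1 := by
      have hc := ZMod.val_coe_unit_coprime u
      have : Nat.Coprime (u : ZMod (2 ^ m)).val 2 :=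
        Nat.Coprime.coprime_dvd_right (dvd_pow_self 2 (by omega)) hc
      exact Nat.odd_iff.mp (Nat.coprime_two_right.mp this)
    have hlt := ZMod.val_lt (u : ZMod (2 ^ m))
    unfold tamePart depth
    simp only [if_true]
    split_ifs with hc1
    · rw [inv_one, mul_one, congOne_iff]
      show (u : ZMod (2 ^ m)).val % 2 ^ 2 = 1 % 2 ^ 2
      norm_num
      omega
    · rw [inv_neg_one, mul_neg, mul_one, congOne_iff, Units.val_neg, ZMod.neg_val,
        if_neg (Units.ne_zero u)]
      show (2 ^ m - (u : ZMod (2 ^ m)).val) % 2 ^ 2 = 1 % 2 ^ 2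
      norm_num
      omega
  · unfold tamePart depth
    simp only [if_neg h2]
    exact congOne_mul_pow_inv hm1 u

/-- **`V ∩ U = 1`**: a unit in `V` that is `≡ 1 (mod M^{depth M})` is `1`.
[cite: Sinnott1987, §1.1] -/
theorem eq_one_of_isTors_of_congOne (hm : depth M ≤ m) {v : (ZMod (M ^ m))ˣ} (hv : IsTors v)
    (hc : CongOne (depth M) (v : ZMod (M ^ m))) : v = 1 := by
  have hm1 : 1 ≤ m := le_trans (one_le_depth M) hm
  unfold IsTors at hv
  rcases hv with ⟨h2, hv⟩ | ⟨h2, hv⟩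
  · rcases hv with rfl | rfl
    · rfl
    · exfalso
      subst h2
      have hm2 : 2 ≤ m := by unfold depth at hm; rwa [if_pos rfl] at hm
      have h1lt : Fact (1 < 2 ^ m) := ⟨Nat.one_lt_pow (by omega) (by norm_num)⟩
      unfold depth at hc
      rw [if_pos rfl, congOne_iff, Units.val_neg, Units.val_one, ZMod.neg_val, if_neg one_ne_zero,
        ZMod.val_one] at hc
      have h4 : 4 ∣ 2 ^ m := dvd_trans (by norm_num : 4 ∣ 2 ^ 2) (pow_dvd_pow 2 hm2)
      obtain ⟨t, ht⟩ := h4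
      change (2 ^ m - 1) % 2 ^ 2 = 1 % 2 ^ 2 at hc
      norm_num at hc
      omega
  · have hd : depth M = 1 := by unfold depth; rw [if_neg h2]
    rw [hd] at hc
    have h2le := hM.out.two_le
    refine eq_one_of_congOne_of_pow_eq_one (k := M - 1) hm1 ?_ (by omega) (hd ▸ hc) hv
    intro h
    have := Nat.le_of_dvd (by omega) h
    omega

/-- **Every unit of `ℤ/M^m` has its `M^{m - depth M}`-th power in `V`** (`depth M ≤ m`):
`(ℤ/M^m)ˣ = V × U` with `U` of exponent `M^{m - depth M}`. [cite: Sinnott1987, §1.1] -/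
theorem isTors_pow_pow_sub_depth (hm : depth M ≤ m) (u : (ZMod (M ^ m))ˣ) :
    IsTors (u ^ M ^ (m - depth M)) := by
  have hm1 : 1 ≤ m := le_trans (one_le_depth M) hm
  have hw : CongOne (depth M) ((u * (tamePart u)⁻¹ : (ZMod (M ^ m))ˣ) : ZMod (M ^ m)) :=
    congOne_mul_tamePart_inv hm u
  have hpow : (u * (tamePart u)⁻¹) ^ M ^ (m - depth M) = 1 :=
    pow_pow_eq_one_of_congOne le_rfl hm1 (by omega) hw
  have : u ^ M ^ (m - depth M) = (tamePart u) ^ M ^ (m - depth M) := by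
    rw [mul_pow, inv_pow, mul_inv_eq_one] at hpow
    exact hpow
  rw [this]
  exact (isTors_tamePart hm1 u).pow _

/-- **Existence and uniqueness of the decomposition `u = v · w`, `v ∈ V`, `w ≡ 1 (mod M^j)`, for
the units with `u^{M^{m-j}} ∈ V`** (`depth M ≤ j ≤ m`): the finite shadow of `ℤ_Mˣ = V × U`.
[cite: Sinnott1987, §1.1 and (3.3)] -/
theorem decomp_exists {j : ℕ} (hj : depth M ≤ j) (hjm : j ≤ m) (u : (ZMod (M ^ m))ˣ)
    (hu : IsTors (u ^ M ^ (m - j))) :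
    ∃ v w : (ZMod (M ^ m))ˣ, IsTors v ∧ CongOne j (w : ZMod (M ^ m)) ∧ u = v * w := by
  have hm1 : 1 ≤ m := le_trans (one_le_depth M) (le_trans hj hjm)
  refine ⟨tamePart u, u * (tamePart u)⁻¹, isTors_tamePart hm1 u, ?_,
    by rw [mul_comm, inv_mul_cancel_right]⟩
  have hw : CongOne (depth M) ((u * (tamePart u)⁻¹ : (ZMod (M ^ m))ˣ) : ZMod (M ^ m)) :=
    congOne_mul_tamePart_inv (le_trans hj hjm) u
  have hpow : (u * (tamePart u)⁻¹) ^ M ^ (m - j) = 1 := by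
    refine eq_one_of_isTors_of_congOne (le_trans hj hjm) ?_ ?_
    · rw [mul_pow, inv_pow]
      exact hu.mul ((isTors_tamePart hm1 u).pow _).inv
    · rw [Units.val_pow_eq_pow_val]
      exact hw.pow (le_trans hj hjm) hm1 _
  have := congOne_of_pow_pow_eq_one hm1 (Nat.sub_le m j) hw hpow
  rwa [Nat.sub_sub_self hjm] at this

/-- Uniqueness of the decomposition `u = v · w`, `v ∈ V`, `w ≡ 1 (mod M^j)` (`depth M ≤ j ≤ m`).
[cite: Sinnott1987, §1.1] -/
theorem decomp_unique {j : ℕ} (hj : depth M ≤ j) (hjm : j ≤ m) {v w v' w' : (ZMod (M ^ m))ˣ}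
    (hv : IsTors v) (hw : CongOne j (w : ZMod (M ^ m))) (hv' : IsTors v')
    (hw' : CongOne j (w' : ZMod (M ^ m))) (h : v * w = v' * w') : v = v' ∧ w = w' := by
  have hm1 : 1 ≤ m := le_trans (one_le_depth M) (le_trans hj hjm)
  have h1 : v⁻¹ * v' = w * w'⁻¹ := by
    rw [inv_mul_eq_iff_eq_mul, ← mul_assoc, h, mul_assoc, mul_inv_cancel, mul_one]
  have htors : IsTors (v⁻¹ * v') := hv.inv.mul hv'
  have hcong : CongOne (depth M) ((v⁻¹ * v' : (ZMod (M ^ m))ˣ) : ZMod (M ^ m)) := by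
    rw [h1, Units.val_mul]
    exact ((hw.mul hjm (hw'.inv hjm hm1))).mono hj
  have := eq_one_of_isTors_of_congOne (le_trans hj hjm) htors hcong
  have hvv : v = v' := by rwa [inv_mul_eq_one] at this
  refine ⟨hvv, ?_⟩
  rw [hvv] at h
  exact mul_left_cancel h

/-- `(v w)^{M^{m-j}} ∈ V` for `v ∈ V`, `w ≡ 1 (mod M^j)`. [folklore] -/
theorem isTors_pow_of_decomp {j : ℕ} (hj : depth M ≤ j) (hjm : j ≤ m) {v w : (ZMod (M ^ m))ˣ}
    (hv : IsTors v) (hw : CongOne j (w : ZMod (M ^ m))) : IsTors ((v * w) ^ M ^ (m - j)) := by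
  have hm1 : 1 ≤ m := le_trans (one_le_depth M) (le_trans hj hjm)
  rw [mul_pow, pow_pow_eq_one_of_congOne hj hm1 (by omega) hw, mul_one]
  exact hv.pow _

/-- **Splitting a sum over `{u : u^{M^{m-j}} ∈ V}` as a double sum over `V` and `K_j`**
(`1 ≤ j`, `depth M ≤ j ≤ m`). [cite: Sinnott1987, (3.3)] -/
theorem sum_filter_isTors_pow_eq {β : Type*} [AddCommMonoid β] {j : ℕ} (hj1 : 1 ≤ j)
    (hj : depth M ≤ j) (hjm : j ≤ m) (f : (ZMod (M ^ m))ˣ → β) :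
    ∑ u ∈ univ.filter (fun u : (ZMod (M ^ m))ˣ ↦ IsTors (u ^ M ^ (m - j))), f u =
      ∑ v ∈ univ.filter (fun v : (ZMod (M ^ m))ˣ ↦ IsTors v),
        ∑ k ∈ range (M ^ (m - j)), f (v * unitOneAdd m j k) := by
  rw [← sum_product']
  symm
  refine Finset.sum_nbij (fun vk ↦ vk.1 * unitOneAdd m j vk.2) ?_ ?_ ?_ (fun _ _ ↦ rfl)
  · intro vk hvk
    rw [mem_product, mem_filter, mem_range] at hvk
    rw [mem_filter]
    exact ⟨mem_univ _, isTors_pow_of_decomp hj hjm hvk.1.2 (congOne_unitOneAdd hj1 hjm hvk.2)⟩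
  · intro vk hvk vk' hvk' h
    rw [mem_coe, mem_product, mem_filter, mem_range] at hvk hvk'
    obtain ⟨h1, h2⟩ := decomp_unique hj hjm hvk.1.2 (congOne_unitOneAdd hj1 hjm hvk.2) hvk'.1.2
      (congOne_unitOneAdd hj1 hjm hvk'.2) h
    exact Prod.ext h1 (unitOneAdd_injective hj1 hjm hvk.2 hvk'.2 h2)
  · intro u hu
    rw [mem_coe, mem_filter] at hu
    obtain ⟨v, w, hv, hw, rfl⟩ := decomp_exists hj hjm u hu.2
    obtain ⟨k, hk, rfl⟩ := (congOne_iff_exists hj1 hjm w).mp hw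
    exact ⟨(v, k), by rw [mem_coe, mem_product, mem_filter, mem_range]; exact ⟨⟨mem_univ _, hv⟩, hk⟩,
      rfl⟩

end Tors

end Literature.NumberTheory.LFunctions.Sinnott1987
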